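import Summits.QuantumFields.BalabanUV.Beta.EriceRemainderEnclosureHistoryAutonomyComparisonAgeCompositionKeyFree

/-!
# EriceRemainderEnclosureHistoryAutonomyComparisonAgeCompositionAddAge — (E115h) route (N), first order, ABSTRACT: ADDING AN AGE LOWERS THE SURPLUS UP TO THE
# INCREASE OF ITS READS.  Old kernel `K_O` (reads `R_O`, zero-tailed solution operator `S_O` with the END at every truncation), young kernel `K_y ≥ 0` (reads `R_y`);
# `ε` the zero-tailed full surplus of a zero-tailed excess `e` (`ε = e − R_O ε − R_y ε`), `v = S_O e` the old surplus, `r = R_y ε` the young reads of the full surplus.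
# Then the EXACT identity **`sol_eq_old_sub`**: `ε = v − S_O r`, and, with NO sign hypothesis on `r` (the lower BV bound of (E115a) needs none),
# **`sol_le_old_add_increase`**: `ε n ≤ v n + Σ_{J≥n} max (r (J+1) − r J) 0` — THE UPPER HALF OF THE MULTIPLICATIVE DEPTH PROFILE (README
# `HOME/b2b-balaban-beta-d4-p2/g96/README.md` §4 (I), §6 (1)): the surplus of the larger system exceeds the old one at most by the total INCREASE of the young
# reads below the pin (small: the young reads decay with the depth), so the depth profile `ε(m) ≤ C·Π_{k_i ≤ m−n} u_i^{−1}·ε(n)` of the old system passes to the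
# new one with the young factor `u_y^{−1}` (from (E115a∕b) `ε n ≥ u_y·v n − …`) and the SAME constant — measured `C ≤ 1.42` on every configuration, admissible or not
# (kit `g96law6` j343512).

Cell `pub-balaban`, β-function sub-cell, BINDER row D4 «RemainderConst leaves for Bałaban's split» (`HOME/BINDER-OWNERS.md`; owner lineage `b2b-balaban-beta-an4`;
this file by co-owner #2 lineage `b2b-balaban-beta-d4-p2`, generation 96), β-FLOW TEAM duty (1), FREEZE (0) honoured (def-free; imports (E115c); uses (E71a)
`sol_unique` ∕ `read_eq_zero_of_tail`, (E115a) `read_add'` ∕ `sol_add` ∕ `sol_ge_var` BY NAME; pure renewal algebra; nothing restated).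

HONEST FRAMING (page 1, verbatim and binding).  *"Discharging BetaPertH makes Bałaban's UV stability UNCONDITIONAL — a real constructive-QFT result; it is
NOT the continuum limit and NOT the Clay problem."*  THIS FILE DISCHARGES NOTHING OF THE KIND.  Elementary linear algebra about ABSTRACT real sequences and
triangular systems — tools for the cell's own first-order census (route (N) of conjecture (E58′)); the form, signs, ages and moments of Bałaban's (1.22) limit
functional are NOT PRINTED ([I] p. 298; GAPS G-t4-U2-1∕-2) and NOT asserted.  Row D4 class UNCHANGED (critical-path width 0; instance 0∕1; D4 DISCHARGE NO
DATE).  HONEST DEPENDENCY: continuum YM on T⁴ ⇐ BetaPertH ∧ nine spine estimates (0/9 proved); BetaPertH ⇐ (D1) ∧ (D4) ∧ CAP+tail; G-an2-4 gates asym, D1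
and NE2/3/4.

NOT CLAIMED: the depth profile itself (open, README §6 (1)); any flow instance; anything printed — NOT B12 Thm 2, NOT BetaPertH, NOT continuum, NOT Clay.

WHAT IS PROVED ([folklore]; 0 `def`, 0 sorry; (E71a)'s conventions).  **`sol_eq_old_sub`** (`ε = S_O e − S_O (R_y ε)`), **`sol_le_old_add_increase`**.
-/
noncomputable section
open Finset

namespace Summit.QuantumFields.BalabanUV.Beta.EriceRemainderEnclosureHistoryAutonomyComparisonAgeCompositionAddAge

open Summit.QuantumFields.BalabanUV.Beta.EriceRemainderEnclosureHistoryAutonomyComparisonAgeComposition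
open Summit.QuantumFields.BalabanUV.Beta.EriceRemainderEnclosureHistoryAutonomyComparisonAgeCompositionBVStability

variable {N : ℕ} {KO Ky : ℕ → ℕ → ℝ} {RO Ry SO : (ℕ → ℝ) → ℕ → ℝ}

/-- **ADDING AN AGE: THE EXACT IDENTITY.**  `ε = S_O e − S_O (R_y ε)`: the full surplus is the old surplus of the excess minus the old surplus of the young reads
of the full surplus (`ε + R_O ε = e − R_y ε` and uniqueness∕linearity of the old solution operator). [folklore] -/
theorem sol_eq_old_sub
    (hRO : ∀ v n, RO v n = ∑ l ∈ range N, KO n l * v (n + 1 + l))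
    (hRy : ∀ v n, Ry v n = ∑ l ∈ range N, Ky n l * v (n + 1 + l))
    (hSO : ∀ w : ℕ → ℝ, (∀ n, N < n → w n = 0) → (∀ n, N < n → SO w n = 0) ∧ ∀ n, SO w n = w n - RO (SO w) n)
    {e : ℕ → ℝ} (he : ∀ n, N < n → e n = 0)
    {ε : ℕ → ℝ} (hεtail : ∀ n, N < n → ε n = 0) (hεrec : ∀ n, ε n = e n - RO ε n - Ry ε n) :
    ∀ n, ε n = SO e n - SO (Ry ε) n := by
  have hRyt : ∀ m, N < m → Ry ε m = 0 := fun m hm =>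
    read_eq_zero_of_tail (c := 0) hRy (fun k hk => hεtail k (by simpa using hk)) m (by omega)
  have hwt : ∀ m, N < m → (fun m => e m + (-1) * Ry ε m) m = 0 := fun m hm => by simp only [he m hm, hRyt m hm, mul_zero, add_zero]
  -- ε solves the old system with input e − R_y ε
  have hεO : ∀ m, ε m = (fun m => e m + (-1) * Ry ε m) m - RO ε m := fun m => by simp only; linarith [hεrec m]
  have h1 : ∀ n, ε n = SO (fun m => e m + (-1) * Ry ε m) n := fun n =>
    (sol_unique hRO (hSO _ hwt).1 (hSO _ hwt).2 hεtail hεO n).symm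
  -- linearity: S_O (e − r) = S_O e − S_O r
  have hnt : ∀ m, N < m → (fun m => (-1) * Ry ε m) m = 0 := fun m hm => by simp only [hRyt m hm, mul_zero]
  have h2 := sol_add hRO hSO he hnt
  have h3 : ∀ n, SO (fun m => (-1) * Ry ε m) n = (-1) * SO (Ry ε) n := by
    -- the solution of a scaled input is the scaled solution
    have hut : ∀ m, N < m → (fun m => (-1) * SO (Ry ε) m) m = 0 := fun m hm => by simp only [(hSO _ hRyt).1 m hm, mul_zero]
    have hurec : ∀ m, (fun m => (-1) * SO (Ry ε) m) m = (fun m => (-1) * Ry ε m) m - RO (fun m => (-1) * SO (Ry ε) m) m := fun m => by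
      simp only [read_smul hRO]
      have := (hSO _ hRyt).2 m
      linarith
    exact fun n => sol_unique hRO (hSO _ hnt).1 (hSO _ hnt).2 hut hurec n
  intro n
  rw [h1 n, h2 n, h3 n]; ring

/-- **ADDING AN AGE LOWERS THE SURPLUS UP TO THE INCREASE OF ITS READS.**  If the old solution operator has the END at every truncation, then for every pin
`ε n ≤ S_O e n + Σ_{n≤J≤N} max (R_y ε (J+1) − R_y ε J) 0` ((E115a) `sol_ge_var` with the floor `0`; no sign hypothesis on the young reads). [folklore] -/
theorem sol_le_old_add_increase
    (hRO : ∀ v n, RO v n = ∑ l ∈ range N, KO n l * v (n + 1 + l))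
    (hRy : ∀ v n, Ry v n = ∑ l ∈ range N, Ky n l * v (n + 1 + l))
    (hSO : ∀ w : ℕ → ℝ, (∀ n, N < n → w n = 0) → (∀ n, N < n → SO w n = 0) ∧ ∀ n, SO w n = w n - RO (SO w) n)
    (hENDO : ∀ J n, J ≤ N → 0 ≤ SO (fun m => if m ≤ J then (1 : ℝ) else 0) n ∧ SO (fun m => if m ≤ J then (1 : ℝ) else 0) n ≤ 1)
    {e : ℕ → ℝ} (he : ∀ n, N < n → e n = 0)
    {ε : ℕ → ℝ} (hεtail : ∀ n, N < n → ε n = 0) (hεrec : ∀ n, ε n = e n - RO ε n - Ry ε n) (n : ℕ) :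
    ε n ≤ SO e n + ∑ J ∈ Ico n (N + 1), max (Ry ε (J + 1) - Ry ε J) 0 := by
  have hRyt : ∀ m, N < m → Ry ε m = 0 := fun m hm =>
    read_eq_zero_of_tail (c := 0) hRy (fun k hk => hεtail k (by simpa using hk)) m (by omega)
  rw [sol_eq_old_sub hRO hRy hSO he hεtail hεrec n]
  -- lower bound of S_O r n by (E115a) `sol_ge_var` with the floor 0: S_O r n ≥ Σ_J min (r J − r (J+1)) 0 = −Σ_J max (r (J+1) − r J) 0
  have h := sol_ge_var hRO hSO hENDO hRyt (n := n) (u := 0) (fun J _ hJN => (hENDO J n hJN).1)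
  rw [zero_mul, zero_add] at h
  have hmin : ∀ J, min (Ry ε J - Ry ε (J + 1)) 0 = -max (Ry ε (J + 1) - Ry ε J) 0 := fun J => by
    rw [min_def, max_def]; split_ifs <;> linarith
  simp_rw [hmin, sum_neg_distrib] at h
  linarith

end Summit.QuantumFields.BalabanUV.Beta.EriceRemainderEnclosureHistoryAutonomyComparisonAgeCompositionAddAge

end
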